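import Mathlib.LinearAlgebra.CrossProduct
import Mathlib.LinearAlgebra.Matrix.Trace
import Mathlib.Data.Real.Basic
import Mathlib.Tactic
import HarnessLib

/-!
# Hamilton's self-dual and anti-self-dual bases of `Λ²ℝ⁴` as `4 × 4` skew matrices: the
quaternionic identities and the sign conventions (topic `Geometry/Riemannian`)

A brick of the printed proof of the named fact
`Literature.Geometry.Riemannian.hamilton_nonnegCurvatureOperator_classification_four`
(`HamiltonNCOClassification.lean`; R. S. Hamilton, *Four-manifolds with positive curvature
operator*, J. Differential Geom. 24 (1986), Thm. 1.3), and the certification of a convention used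
throughout the tree's Hamilton-1986 chain. The block decomposition `M = (A B; ᵗB C)` of the
curvature operator (`CurvatureDecomposition.lean`) refers to Hamilton's bases (1997, p. 5)
`φ₁ = e₀∧e₁ + e₂∧e₃`, `φ₂ = e₀∧e₂ + e₃∧e₁`, `φ₃ = e₀∧e₃ + e₁∧e₂` of `Λ²₊` and
`ψ₁ = e₀∧e₁ - e₂∧e₃`, `ψ₂ = e₀∧e₂ - e₃∧e₁`, `ψ₃ = e₀∧e₃ - e₁∧e₂` of `Λ²₋`; the design notes of
`HamiltonCurvatureODE.lean` record, unproved, that for these "one checks `[φ₁, φ₂] = -2φ₃` but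
`[ψ₁, ψ₂] = +2ψ₃`", which is why Hamilton's printed ODE `B' = AB + BC + 2B^#` carries `-2B^#` in
the tree's frame convention, why the named fact `hamilton_maximumPrinciple_curvatureODE` is stated
with a `B ↦ -B` symmetry hypothesis, and why the bricks `HamiltonImageLieSubalgebra.lean` /
`HamiltonHolonomySubalgebras.lean` distinguish the printed bracket `(x × x', y × y')` from the
frame bracket `(x × x', -(y × y'))`. This file PROVES these conventions by computing with the
`4 × 4` skew matrices of frame components (`ω_{ij} = ω(eᵢ, eⱼ)`, the arrays of
`DecomposableBivectorsFour.lean` and of the coordinates of `curvatureOperatorForm_eq_quad_blocks`):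

* `SkewFour.wedge a b`, `sdBasis`, `asdBasis`, `sd x = Σ xₛ φₛ`, `asd y = Σ yₛ ψₛ` — the matrices
  (plain data, no named facts).
* `sd_mul_sd`, `asd_mul_asd`, `sd_mul_asd_comm` — **the quaternionic rules**
  `Φ(x)Φ(x') = -⟨x,x'⟩1 - Φ(x × x')`, `Ψ(y)Ψ(y') = -⟨y,y'⟩1 + Ψ(y × y')`, `Φ(x)Ψ(y) = Ψ(y)Φ(x)`
  (`Λ²ℝ⁴ = so(4) = so(3) ⊕ so(3)`, the two ideals commuting);
* `sd_commutator`, `asd_commutator`, `commutator_sd_add_asd` — **`[Φ(x), Φ(x')] = -2Φ(x × x')`,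
  `[Ψ(y), Ψ(y')] = +2Ψ(y × y')`**: the recorded signs, so that the bracket of `so(4)` in block
  coordinates `(x, y)` is `(-2 x × x', +2 y × y') ∝ (x × x', -(y × y'))`;
* `sd_mul_self`, `asd_mul_self`, `sd_add_asd_mul_self`, `trace_sd_mul_asd`,
  `trace_sd_add_asd_sq` — squares and norms (`-¼ tr ω² = |x|² + |y|²`);
* `sd_add_asd_apply_zero_succ`, `sd_add_asd_apply_compl`, `eq_sd_add_asd` — **coordinates**: the
  `Λ²₊ ⊕ Λ²₋`-coordinates of `Φ(x) + Ψ(y)` are `(x, y)` (entries `xₛ + yₛ` on `(0, s+1)`,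
  `xₛ - yₛ` on `(2,3),(3,1),(1,2)`), and every skew array is `Φ(x) + Ψ(y)`;
* `sd_add_asd_mul_sd_sub_asd(_eq_zero)` — **§9, case 3 (p. 178): "If we take them to have unit
  length, then `φ + ψ` and `φ - ψ` are two perpendicular 2-planes"**:
  `(Φ(x) + Ψ(y))(Φ(x) - Ψ(y)) = (|y|² - |x|²) 1`, zero for `|x| = |y|` (the two 2-forms being
  decomposable by `DecomposableBivectorsFour.lean`).

## References

* R. S. Hamilton, *Four-manifolds with positive curvature operator*, J. Differential Geom. 24
  (1986) 153–179, §6 (p. 166, the block system), §9, case 3 (p. 178). [Hamilton1986]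
* R. S. Hamilton, Comm. Anal. Geom. 5 (1997), §1.2, pp. 4–5 (the bases `φᵢ`, `ψᵢ`). [Hamilton1997]
-/

noncomputable section

open Matrix Finset
open scoped BigOperators

namespace Literature.Geometry.Riemannian

namespace SkewFour

/-- The skew matrix of the elementary 2-form `e_a ∧ e_b`: entry `(i, j)` is
`δ_{ai} δ_{bj} - δ_{aj} δ_{bi}` (the frame components `(e_a ∧ e_b)(eᵢ, eⱼ)`). [folklore] -/
def wedge (a b : Fin 4) : Matrix (Fin 4) (Fin 4) ℝ :=
  Matrix.of fun i j ↦ (if a = i ∧ b = j then 1 else 0) - (if a = j ∧ b = i then 1 else 0)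

/-- Hamilton's self-dual basis `φ₁ = e₀∧e₁ + e₂∧e₃`, `φ₂ = e₀∧e₂ + e₃∧e₁`, `φ₃ = e₀∧e₃ + e₁∧e₂`
(1997, p. 5; `selfDualPairs` of `CurvatureDecomposition.lean`) as skew matrices of frame
components. [cite: Hamilton1997, §1.2, p. 5] -/
def sdBasis : Fin 3 → Matrix (Fin 4) (Fin 4) ℝ :=
  ![wedge 0 1 + wedge 2 3, wedge 0 2 + wedge 3 1, wedge 0 3 + wedge 1 2]

/-- Hamilton's anti-self-dual basis `ψ₁ = e₀∧e₁ - e₂∧e₃`, `ψ₂ = e₀∧e₂ - e₃∧e₁`,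
`ψ₃ = e₀∧e₃ - e₁∧e₂` (signs absorbed as in `antiSelfDualPairs`: `e₀∧e₁ + e₃∧e₂`, …).
[cite: Hamilton1997, §1.2, p. 5] -/
def asdBasis : Fin 3 → Matrix (Fin 4) (Fin 4) ℝ :=
  ![wedge 0 1 + wedge 3 2, wedge 0 2 + wedge 1 3, wedge 0 3 + wedge 2 1]

/-- The self-dual 2-form with `Λ²₊`-coordinates `x`: `Σₛ xₛ φₛ`. [cite: Hamilton1997, §1.2, p. 5] -/
def sd (x : Fin 3 → ℝ) : Matrix (Fin 4) (Fin 4) ℝ := ∑ s, x s • sdBasis s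

/-- The anti-self-dual 2-form with `Λ²₋`-coordinates `y`: `Σₛ yₛ ψₛ`. [cite: Hamilton1997, §1.2, p. 5] -/
def asd (y : Fin 3 → ℝ) : Matrix (Fin 4) (Fin 4) ℝ := ∑ s, y s • asdBasis s

/-- Entries of `sd x`. [folklore] -/
theorem sd_apply (x : Fin 3 → ℝ) (i j : Fin 4) :
    sd x i j = ∑ s, x s * sdBasis s i j := by
  simp [sd, Matrix.sum_apply]

/-- Entries of `asd y`. [folklore] -/
theorem asd_apply (y : Fin 3 → ℝ) (i j : Fin 4) :
    asd y i j = ∑ s, y s * asdBasis s i j := by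
  simp [asd, Matrix.sum_apply]

/-- **The quaternionic rule for self-dual forms**: `Φ(x) Φ(x') = -⟨x, x'⟩ 1 - Φ(x × x')`
(`Φ = sd`; the `φₛ` anti-commute like imaginary quaternions, `φₛ² = -1`). [folklore] -/
theorem sd_mul_sd (x x' : Fin 3 → ℝ) :
    sd x * sd x' = -(x ⬝ᵥ x') • (1 : Matrix (Fin 4) (Fin 4) ℝ) - sd (x ⨯₃ x') := by
  ext i j
  simp only [Matrix.mul_apply, sd_apply, Fin.sum_univ_four, Fin.sum_univ_three, sdBasis, wedge,
    Matrix.sub_apply, Matrix.smul_apply, Matrix.one_apply, cross_apply,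
    dotProduct, Matrix.of_apply, Matrix.cons_val_zero, Matrix.cons_val_one, Matrix.cons_val,
    Matrix.add_apply, smul_eq_mul]
  fin_cases i <;> fin_cases j <;> simp <;> ring

/-- **The quaternionic rule for anti-self-dual forms, with the OPPOSITE sign**:
`Ψ(y) Ψ(y') = -⟨y, y'⟩ 1 + Ψ(y × y')` (`Ψ = asd`). [folklore] -/
theorem asd_mul_asd (y y' : Fin 3 → ℝ) :
    asd y * asd y' = -(y ⬝ᵥ y') • (1 : Matrix (Fin 4) (Fin 4) ℝ) + asd (y ⨯₃ y') := by
  ext i j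
  simp only [Matrix.mul_apply, asd_apply, Fin.sum_univ_four, Fin.sum_univ_three, asdBasis, wedge,
    Matrix.smul_apply, Matrix.one_apply, cross_apply,
    dotProduct, Matrix.of_apply, Matrix.cons_val_zero, Matrix.cons_val_one, Matrix.cons_val,
    Matrix.add_apply, smul_eq_mul]
  fin_cases i <;> fin_cases j <;> simp <;> ring

/-- **Self-dual and anti-self-dual forms commute**: `Φ(x) Ψ(y) = Ψ(y) Φ(x)`
(`so(4) = so(3) ⊕ so(3)` is a direct sum of ideals). [folklore] -/
theorem sd_mul_asd_comm (x y : Fin 3 → ℝ) : sd x * asd y = asd y * sd x := by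
  ext i j
  simp only [Matrix.mul_apply, sd_apply, asd_apply, Fin.sum_univ_four, Fin.sum_univ_three, sdBasis,
    asdBasis, wedge, Matrix.of_apply, Matrix.cons_val_zero, Matrix.cons_val_one,
    Matrix.cons_val, Matrix.add_apply]
  fin_cases i <;> fin_cases j <;> simp <;> ring

/-- `Φ(-x) = -Φ(x)`. [folklore] -/
theorem sd_neg (x : Fin 3 → ℝ) : sd (-x) = -sd x := by
  ext i j
  simp [sd_apply, Finset.sum_neg_distrib]

/-- `Ψ(-y) = -Ψ(y)`. [folklore] -/
theorem asd_neg (y : Fin 3 → ℝ) : asd (-y) = -asd y := by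
  ext i j
  simp [asd_apply, Finset.sum_neg_distrib]

/-! ### The sign conventions: commutators -/

/-- **`[Φ(x), Φ(x')] = -2 Φ(x × x')`**: in particular `[φ₁, φ₂] = -2 φ₃` for Hamilton's self-dual
basis, as matrix commutators of the frame-component arrays — the sign recorded in the design notes
of `HamiltonCurvatureODE.lean` ("for the printed bases of Hamilton 1997, p. 5 … one checks
`[φ₁, φ₂] = -2φ₃` but `[ψ₁, ψ₂] = +2ψ₃`"), here PROVED. [cite: Hamilton1997, §1.2, p. 5] -/
theorem sd_commutator (x x' : Fin 3 → ℝ) :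
    sd x * sd x' - sd x' * sd x = (-2 : ℝ) • sd (x ⨯₃ x') := by
  rw [sd_mul_sd, sd_mul_sd, dotProduct_comm x' x, ← cross_anticomm x x', sd_neg]
  module

/-- **`[Ψ(y), Ψ(y')] = +2 Ψ(y × y')`**: `[ψ₁, ψ₂] = +2 ψ₃` for the anti-self-dual basis — the
opposite chirality. Consequently the Lie bracket of `so(4)` in the coordinates `(x, y)` of the
tree's frame convention is `((x, y), (x', y')) ↦ (-2 x × x', +2 y × y')`, i.e. proportional to
`(x × x', -(y × y'))`, as used in the `FrameConvention` sections of
`HamiltonImageLieSubalgebra.lean` / `HamiltonHolonomySubalgebras.lean`.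
[cite: Hamilton1997, §1.2, p. 5] -/
theorem asd_commutator (y y' : Fin 3 → ℝ) :
    asd y * asd y' - asd y' * asd y = (2 : ℝ) • asd (y ⨯₃ y') := by
  rw [asd_mul_asd, asd_mul_asd, dotProduct_comm y' y, ← cross_anticomm y y', asd_neg]
  module

/-- **The bracket of a general pair**: for `ω = Φ(x) + Ψ(y)`, `ω' = Φ(x') + Ψ(y')`,
`[ω, ω'] = -2 Φ(x × x') + 2 Ψ(y × y')`. [folklore] -/
theorem commutator_sd_add_asd (x y x' y' : Fin 3 → ℝ) :
    (sd x + asd y) * (sd x' + asd y') - (sd x' + asd y') * (sd x + asd y) =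
      (-2 : ℝ) • sd (x ⨯₃ x') + (2 : ℝ) • asd (y ⨯₃ y') := by
  rw [← sd_commutator, ← asd_commutator]
  simp only [Matrix.add_mul, Matrix.mul_add, sd_mul_asd_comm x y', sd_mul_asd_comm x' y]
  abel

/-! ### Squares, traces, norms -/

/-- `Φ(x)² = -|x|² 1`. [folklore] -/
theorem sd_mul_self (x : Fin 3 → ℝ) : sd x * sd x = -(x ⬝ᵥ x) • (1 : Matrix (Fin 4) (Fin 4) ℝ) := by
  rw [sd_mul_sd, cross_self]
  have : sd 0 = 0 := by ext i j; simp [sd_apply]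
  rw [this, sub_zero]

/-- `Ψ(y)² = -|y|² 1`. [folklore] -/
theorem asd_mul_self (y : Fin 3 → ℝ) : asd y * asd y = -(y ⬝ᵥ y) • (1 : Matrix (Fin 4) (Fin 4) ℝ) := by
  rw [asd_mul_asd, cross_self]
  have : asd 0 = 0 := by ext i j; simp [asd_apply]
  rw [this, add_zero]

/-- **`(Φ(x) + Ψ(y))² = -(|x|² + |y|²) 1 + 2 Φ(x) Ψ(y)`**. [folklore] -/
theorem sd_add_asd_mul_self (x y : Fin 3 → ℝ) :
    (sd x + asd y) * (sd x + asd y) =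
      -(x ⬝ᵥ x + y ⬝ᵥ y) • (1 : Matrix (Fin 4) (Fin 4) ℝ) + (2 : ℝ) • (sd x * asd y) := by
  rw [Matrix.add_mul, Matrix.mul_add, Matrix.mul_add, sd_mul_self, asd_mul_self,
    ← sd_mul_asd_comm]
  module

/-- `tr (Φ(x) Ψ(y)) = 0` (`Λ²₊ ⊥ Λ²₋`). [folklore] -/
theorem trace_sd_mul_asd (x y : Fin 3 → ℝ) : (sd x * asd y).trace = 0 := by
  simp only [Matrix.trace, Matrix.diag, Matrix.mul_apply, sd_apply, asd_apply, Fin.sum_univ_four,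
    Fin.sum_univ_three, sdBasis, asdBasis, wedge, Matrix.of_apply, Matrix.cons_val_zero,
    Matrix.cons_val_one, Matrix.cons_val, Matrix.add_apply]
  simp
  ring

/-- **The norm**: `-¼ tr (Φ(x) + Ψ(y))² = |x|² + |y|²` (`= ½ Σ_{i<j} ω_{ij}²`; the bases `φₛ`,
`ψₛ` are orthogonal of the same length). [folklore] -/
theorem trace_sd_add_asd_sq (x y : Fin 3 → ℝ) :
    ((sd x + asd y) * (sd x + asd y)).trace = -4 * (x ⬝ᵥ x + y ⬝ᵥ y) := by
  rw [sd_add_asd_mul_self, Matrix.trace_add, Matrix.trace_smul, Matrix.trace_smul,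
    trace_sd_mul_asd, Matrix.trace_one, Fintype.card_fin]
  simp
  ring

/-! ### Coordinates: every skew array is `Φ(x) + Ψ(y)` -/

/-- **The `Λ²₊ ⊕ Λ²₋`-coordinates of `Φ(x) + Ψ(y)`** are `(x, y)`: on the pairs `(0, s+1)` the
entries are `xₛ + yₛ` and on the complementary pairs `(2,3), (3,1), (1,2)` they are `xₛ - yₛ` —
the coordinates used in `curvatureOperatorForm_eq_quad_blocks` (`CurvatureOperatorFormFrame.lean`)
and `DecomposableBivectorsFour.lean`. [cite: Hamilton1997, §1.2, p. 5] -/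
theorem sd_add_asd_apply_zero_succ (x y : Fin 3 → ℝ) (s : Fin 3) :
    (sd x + asd y) 0 s.succ = x s + y s := by
  fin_cases s <;>
    simp [Matrix.add_apply, sd_apply, asd_apply, Fin.sum_univ_three, sdBasis, asdBasis, wedge]

/-- The entries of `Φ(x) + Ψ(y)` on the complementary pairs. [cite: Hamilton1997, §1.2, p. 5] -/
theorem sd_add_asd_apply_compl (x y : Fin 3 → ℝ) (s : Fin 3) :
    (sd x + asd y) ((![2, 3, 1] : Fin 3 → Fin 4) s) ((![3, 1, 2] : Fin 3 → Fin 4) s) = x s - y s := by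
  fin_cases s <;>
    simp [Matrix.add_apply, sd_apply, asd_apply, Fin.sum_univ_three, sdBasis, asdBasis, wedge] <;>
    ring

/-- `Φ(x) + Ψ(y)` is skew. [folklore] -/
theorem sd_add_asd_skew (x y : Fin 3 → ℝ) (i j : Fin 4) :
    (sd x + asd y) i j = -(sd x + asd y) j i := by
  simp only [Matrix.add_apply, sd_apply, asd_apply, Fin.sum_univ_three, sdBasis, asdBasis, wedge,
    Matrix.of_apply, Matrix.cons_val_zero, Matrix.cons_val_one, Matrix.cons_val, Matrix.add_apply]
  fin_cases i <;> fin_cases j <;> simp <;> ring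

/-- **Every skew `4 × 4` array is `Φ(x) + Ψ(y)`** for its `Λ²₊ ⊕ Λ²₋`-coordinates
`xₛ = ½(c₀,ₛ₊₁ + c_{p,q})`, `yₛ = ½(c₀,ₛ₊₁ - c_{p,q})` (`Λ²ℝ⁴ = Λ²₊ ⊕ Λ²₋`).
[cite: Hamilton1997, §1.2, pp. 4–5] -/
theorem eq_sd_add_asd {c : Fin 4 → Fin 4 → ℝ} (hc : ∀ i j, c i j = -c j i) :
    ∀ i j, c i j =
      (sd (fun s ↦ (c 0 s.succ + c ((![2, 3, 1] : Fin 3 → Fin 4) s) ((![3, 1, 2] : Fin 3 → Fin 4) s)) / 2) +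
        asd (fun s ↦ (c 0 s.succ - c ((![2, 3, 1] : Fin 3 → Fin 4) s) ((![3, 1, 2] : Fin 3 → Fin 4) s)) / 2))
          i j := by
  have d : ∀ i, c i i = 0 := fun i ↦ by have := hc i i; linarith
  have h10 := hc 1 0; have h20 := hc 2 0; have h30 := hc 3 0
  have h21 := hc 2 1; have h31 := hc 3 1; have h32 := hc 3 2
  intro i j
  simp only [Matrix.add_apply, sd_apply, asd_apply, Fin.sum_univ_three, sdBasis, asdBasis, wedge,
    Matrix.of_apply, Matrix.cons_val_zero, Matrix.cons_val_one, Matrix.cons_val, Matrix.add_apply,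
    Fin.succ_zero_eq_one, Fin.succ_one_eq_two]
  have e3 : Fin.succ (2 : Fin 3) = (3 : Fin 4) := rfl
  simp only [e3]
  fin_cases i <;> fin_cases j <;> simp [d, h10, h20, h30, h21, h31, h32] <;> ring

/-! ### Case 3 of §9: "`φ + ψ` and `φ - ψ` are two perpendicular 2-planes" -/

/-- **`(Φ(x) + Ψ(y)) (Φ(x) - Ψ(y)) = (|y|² - |x|²) 1`**; so for `|x| = |y|` the two decomposable
2-forms `φ + ψ`, `φ - ψ` (`DecomposableBivectorsFour.lean`) have product zero as skew
endomorphisms, i.e. they are complementary orthogonal 2-planes (Hamilton 1986, §9, case 3,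
p. 178: "If we take them to have unit length, then `φ + ψ` and `φ - ψ` are two perpendicular
2-planes"). [cite: Hamilton1986, §9, case 3 (p. 178)] -/
theorem sd_add_asd_mul_sd_sub_asd (x y : Fin 3 → ℝ) :
    (sd x + asd y) * (sd x - asd y) = (y ⬝ᵥ y - x ⬝ᵥ x) • (1 : Matrix (Fin 4) (Fin 4) ℝ) := by
  rw [Matrix.add_mul, Matrix.mul_sub, Matrix.mul_sub, sd_mul_self, asd_mul_self, sd_mul_asd_comm]
  module

/-- For `|x| = |y|` the planes `φ + ψ` and `φ - ψ` are perpendicular: the product of the two skew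
endomorphisms vanishes (in both orders). [cite: Hamilton1986, §9, case 3 (p. 178)] -/
theorem sd_add_asd_mul_sd_sub_asd_eq_zero {x y : Fin 3 → ℝ} (h : x ⬝ᵥ x = y ⬝ᵥ y) :
    (sd x + asd y) * (sd x - asd y) = 0 ∧ (sd x - asd y) * (sd x + asd y) = 0 := by
  constructor
  · rw [sd_add_asd_mul_sd_sub_asd, h, sub_self, zero_smul]
  · have := sd_add_asd_mul_sd_sub_asd x (-y)
    rw [asd_neg, ← sub_eq_add_neg, sub_neg_eq_add] at this
    rw [this]
    simp [h]

end SkewFour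

end Literature.Geometry.Riemannian

end
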